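import Summits.BirchSwinnertonDyer.BirchSwinnertonDyer.Theorems.GoldfeldK12AdditiveTwoHalfTraceGenusField
import HarnessLib

set_option linter.dupNamespace false -- namespace `…BirchSwinnertonDyer.BirchSwinnertonDyer…` is the cell's (D-0017 nested layout)
set_option autoImplicit false

/-!
# The genus field of `ℚ(√−q)` inside the Hilbert class field, II: the involutions `ρ = θ(γ₀)|_J`, `τ = conj|_J`,
# the coordinates `i = θ_K √q / q`, the fixed field `ℚ(i)` of `ρτ`, and `√−7 ∉ J`

Cell `bsd-goldfeld`, seat `bsd-goldfeld-s1p-c201` (prover, gen 13), order `ROUTE-S1PLUS/planner-g30/c201_GO.txt`;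
`--supports stmt-BirchSwinnertonDyer-20044` (route decl
`Summit.BirchSwinnertonDyer.BirchSwinnertonDyer.Theses.GoldfeldAllTwistsTwoConverse.RankOneTwoConverseCMSevenAdditiveTwo`,
K12₂″). HONEST FRAMING: nothing here proves K12₂″ or BSD; the family `49a1^{(−q)}`, `q ≡ 5 (mod 8)` prime, has
twist-density zero (a witness family, never a closer of item 20044).

Sequel of `…HalfTraceGenusField` (Theses-free). With `J = H_K^{θ(Cl²)} = K ⊕ K√q` (`d_K = −4q`):
* §4 every `g ∈ Gal(H_K/K)` restricts to `J` (`Gal(H_K/K) ≅ Cl` is abelian, so `θ(Cl²)` is normal and `J/K` Galois;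
  Mathlib `AlgEquiv.restrictNormal`), and an element OUTSIDE the squares acts as `√q ↦ −√q` (else it would fix
  `J` pointwise and lie in `Fix(J) = θ(Cl²)`, Galois correspondence); complex conjugation preserves `J ⊂ ℂ`
  (`conj(a + b√q) = ā + b̄√q`, `ι ∘ σ_K = conj ∘ ι` for the conjugation `σ_K` of `K`, tree
  `comp_eq_conjugate_of_ne_id`) and so restricts to a `ℚ`-involution `τ` of `J` (`exists_algEquiv_conj_fixedField`).
* §5 coordinates: `τ√q = √q`, `τ|_K = σ_K`, `τ i = −i` for `i² = −1`, `i := θ_K√q/q` (`θ_K² = −q`), `ρ i = −i` when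
  `ρ|_K = id`, `ρ√q = −√q`; **`Fix(ρτ) = ℚ ⊕ ℚ i`** (`exists_rat_of_rho_tau_fixed`: `ρτ(a + b√q) = σ_K a − σ_K b √q`,
  so `a ∈ ℚ`, `b ∈ ℚθ_K`); **`x² ≠ −7` on `J`** for `q ≠ 7` (`sq_ne_neg_seven`, two layers of `a + bθ` bookkeeping and
  `7`-adic valuations); `[J : ℚ] = 4`. These are exactly the field-theoretic fields `i_sq`, `map_i`, `fixed_ratSpan`,
  `seven` of `X049GenusHalfTraceDatum`.

References: [Cox2013] §6.A Thm. 6.1, §7.B; [Darmon2004] Thm. 3.7; [SilvermanAEC2009] VIII.§1.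
-/

noncomputable section

open scoped Classical ComplexConjugate NNReal

open Literature.NumberTheory.EllipticCurves.ModularForms NumberField
open Literature.Computability.Cryptography.Hallgren2005
open Literature.Computability.Cryptography.Hallgren2005.OrderCl
open Literature.NumberTheory.QuadraticFields.Quadratic

namespace Summit.BirchSwinnertonDyer.BirchSwinnertonDyer.Theorems.GoldfeldGoodTwists

open WeierstrassCurve Literature.NumberTheory.EllipticCurves

section GenusField

variable {K : Type} [Field K] [NumberField K]

/-! ## §4 The two involutions of the genus field: `ρ = θ(γ₀)|_J` and `τ = ` complex conjugation -/

/-- restriction of a Galois automorphism of `H_K/K` to the (Galois, the group being abelian) fixed field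
of the squares. [folklore] -/
theorem exists_algEquiv_restrict_fixedField (hK : IsImaginaryQuadratic K) (ι : K →+* ℂ)
    (θ : ClassGroup (OrderCl.QO hK.negDiscr) ≃* Gal(singularModuliField K ι/K))
    (g : Gal(singularModuliField K ι/K)) :
    ∃ ρ : IntermediateField.fixedField
        (((powMonoidHom 2 : ClassGroup (OrderCl.QO hK.negDiscr) →* _).range).map θ.toMonoidHom) ≃ₐ[K]
      IntermediateField.fixedField
        (((powMonoidHom 2 : ClassGroup (OrderCl.QO hK.negDiscr) →* _).range).map θ.toMonoidHom),
      ∀ x, ((ρ x : IntermediateField.fixedField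
        (((powMonoidHom 2 : ClassGroup (OrderCl.QO hK.negDiscr) →* _).range).map θ.toMonoidHom)) :
          singularModuliField K ι) = g x := by
  obtain ⟨hfd, hgal⟩ := finiteDimensional_and_isGalois_singularModuliField irreducible_classPolynomial_holds hK ι
  set S := ((powMonoidHom 2 : ClassGroup (OrderCl.QO hK.negDiscr) →* _).range).map θ.toMonoidHom with hS
  haveI : S.Normal := hS ▸ normal_map_range_sq θ
  haveI : IsGalois K (IntermediateField.fixedField S) := IsGalois.of_fixedField_normal_subgroup S
  exact ⟨g.restrictNormal _, fun x ↦ AlgEquiv.restrictNormal_commutes g _ x⟩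

/-- an automorphism OUTSIDE the squares acts as `-1` on `√q` (else it would fix `J = K ⊕ K√q` pointwise and
lie in `Fix(J) = squares`). [cite: Cox2013, §6.A Thm. 6.1] -/
theorem gal_apply_sqrt_eq_neg (hK : IsImaginaryQuadratic K) (ι : K →+* ℂ)
    (θ : ClassGroup (OrderCl.QO hK.negDiscr) ≃* Gal(singularModuliField K ι/K)) {q : ℕ} (hq : q.Prime)
    (hq4 : q % 4 = 1) (hdK : NumberField.discr K = -(4 * (q : ℤ))) {g : Gal(singularModuliField K ι/K)}
    (hg : g ∉ ((powMonoidHom 2 : ClassGroup (OrderCl.QO hK.negDiscr) →* _).range).map θ.toMonoidHom)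
    {s : singularModuliField K ι} (hs : s ^ 2 = (q : singularModuliField K ι)) : g s = -s := by
  obtain ⟨hfd, -⟩ := finiteDimensional_and_isGalois_singularModuliField irreducible_classPolynomial_holds hK ι
  rcases gal_apply_sqrt g hs with h | h
  · exfalso
    apply hg
    set S := ((powMonoidHom 2 : ClassGroup (OrderCl.QO hK.negDiscr) →* _).range).map θ.toMonoidHom with hS
    rw [← IntermediateField.fixingSubgroup_fixedField S, IntermediateField.mem_fixingSubgroup_iff]
    intro x hx
    have hsJ : s ∈ IntermediateField.fixedField S := hS ▸ sqrt_mem_fixedField_map_range_sq hK ι θ hs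
    obtain ⟨a, b, hab⟩ := exists_eq_add_mul_sqrt hK ι θ hq hq4 hdK ⟨s, hsJ⟩ hs ⟨x, hx⟩
    have hab' : x = algebraMap K (singularModuliField K ι) a + algebraMap K (singularModuliField K ι) b * s :=
      congrArg Subtype.val hab
    rw [hab', map_add, map_mul, AlgEquiv.commutes, AlgEquiv.commutes, h]
  · exact h

/-- `conj z = -z` for `z² = -1` in `ℂ`. [folklore] -/
theorem conj_eq_neg_of_sq_eq_neg_one {z : ℂ} (hz : z ^ 2 = -1) : conj z = -z := by
  have h1 : z = Complex.I ∨ z = -Complex.I := by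
    have : (z - Complex.I) * (z + Complex.I) = 0 := by linear_combination hz - Complex.I_sq
    rcases mul_eq_zero.mp this with h | h
    · exact Or.inl (sub_eq_zero.mp h)
    · exact Or.inr (eq_neg_of_add_eq_zero_left h)
  rcases h1 with rfl | rfl
  · exact Complex.conj_I
  · rw [map_neg, Complex.conj_I, neg_neg]

/-- **Complex conjugation restricts to an involution `τ` of the genus field** `J = K ⊕ K√q ⊂ H_K ⊂ ℂ`
(`conj (a + b√q) = ā + b̄√q`). [cite: Cox2013, §6.A Thm. 6.1] -/
theorem exists_algEquiv_conj_fixedField (hK : IsImaginaryQuadratic K) (ι : K →+* ℂ)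
    (θ : ClassGroup (OrderCl.QO hK.negDiscr) ≃* Gal(singularModuliField K ι/K)) {q : ℕ} (hq : q.Prime)
    (hq4 : q % 4 = 1) (hdK : NumberField.discr K = -(4 * (q : ℤ))) :
    ∃ τ : IntermediateField.fixedField
        (((powMonoidHom 2 : ClassGroup (OrderCl.QO hK.negDiscr) →* _).range).map θ.toMonoidHom) ≃ₐ[ℚ]
      IntermediateField.fixedField
        (((powMonoidHom 2 : ClassGroup (OrderCl.QO hK.negDiscr) →* _).range).map θ.toMonoidHom),
      ∀ x, (((τ x : IntermediateField.fixedField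
        (((powMonoidHom 2 : ClassGroup (OrderCl.QO hK.negDiscr) →* _).range).map θ.toMonoidHom)) :
          singularModuliField K ι) : ℂ) = conj ((x : singularModuliField K ι) : ℂ) := by
  set S := ((powMonoidHom 2 : ClassGroup (OrderCl.QO hK.negDiscr) →* _).range).map θ.toMonoidHom with hS
  -- the square root of `q` in `J`
  have hmem : ((Real.sqrt q : ℝ) : ℂ) ∈ singularModuliField K ι := sqrt_mem_singularModuliField hK ι hq hq4 hdK
  set s : singularModuliField K ι := ⟨_, hmem⟩ with hs_def
  have hs : s ^ 2 = (q : singularModuliField K ι) := by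
    apply Subtype.ext
    show ((Real.sqrt q : ℝ) : ℂ) ^ 2 = ((q : singularModuliField K ι) : ℂ)
    rw [← Complex.ofReal_pow, Real.sq_sqrt (Nat.cast_nonneg q)]
    simp
  have hsJ : s ∈ IntermediateField.fixedField S := hS ▸ sqrt_mem_fixedField_map_range_sq hK ι θ hs
  set sJ : IntermediateField.fixedField S := ⟨s, hsJ⟩ with hsJ_def
  -- the conjugation of `K` and the embedding
  obtain ⟨θK, hθK⟩ := exists_sq_eq_neg_prime hK hdK
  have hθr := sqrtNeg_not_mem_range_rat hq hθK
  have hc : θK ^ 2 = algebraMap ℚ K (-(q : ℚ)) := by rw [hθK]; simp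
  haveI : NeZero (2 : ℚ) := ⟨two_ne_zero⟩
  set σK := Literature.NumberTheory.QuadraticFields.Quadratic.conj hK.1 hθr hc with hσK
  have hσid : σK ≠ AlgHom.id ℚ K := by
    intro h
    have h1 : σK θK = θK := by rw [h]; rfl
    rw [hσK, conj_gen] at h1
    have : θK = 0 := by linear_combination h1 / (-2)
    exact ne_zero_of_not_mem_range hθr this
  have hισ : ∀ a : K, conj (ι a) = ι (σK a) := fun a ↦ by
    have := RingHom.congr_fun (comp_eq_conjugate_of_ne_id hK ι hσid) a
    simpa using this.symm
  -- coordinates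
  choose a b hab using exists_eq_add_mul_sqrt hK ι θ hq hq4 hdK sJ hs
  let f : IntermediateField.fixedField S → IntermediateField.fixedField S := fun x ↦
    algebraMap K _ (σK (a x)) + algebraMap K _ (σK (b x)) * sJ
  have hemb : Function.Injective fun x : IntermediateField.fixedField S ↦ ((x : singularModuliField K ι) : ℂ) :=
    fun x y h ↦ Subtype.ext (Subtype.ext h)
  have hcoeK : ∀ a : K, (((algebraMap K (IntermediateField.fixedField S) a : IntermediateField.fixedField S) :
      singularModuliField K ι) : ℂ) = ι a := fun a ↦ rfl
  have hcoes : (((sJ : IntermediateField.fixedField S) : singularModuliField K ι) : ℂ) = (Real.sqrt q : ℝ) := rfl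
  have hf : ∀ x, (((f x : IntermediateField.fixedField S) : singularModuliField K ι) : ℂ) =
      conj ((x : singularModuliField K ι) : ℂ) := fun x ↦ by
    conv_rhs => rw [hab x]
    simp only [f, IntermediateField.coe_add, IntermediateField.coe_mul, Subfield.coe_add, Subfield.coe_mul,
      hcoeK, hcoes, map_add, map_mul, Complex.conj_ofReal]
    rw [← hισ, ← hισ]
    rfl
  have hrat : ∀ r : ℚ, (((algebraMap ℚ (IntermediateField.fixedField S) r : IntermediateField.fixedField S) :
      singularModuliField K ι) : ℂ) = (r : ℂ) := fun r ↦ by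
    rw [eq_ratCast]
    simp only [SubfieldClass.coe_ratCast]
  let φ : IntermediateField.fixedField S →ₐ[ℚ] IntermediateField.fixedField S :=
    { toFun := f
      map_one' := hemb (by simp only [hf, OneMemClass.coe_one, map_one])
      map_mul' := fun x y ↦ hemb (by simp only [hf, MulMemClass.coe_mul, map_mul])
      map_zero' := hemb (by simp only [hf, ZeroMemClass.coe_zero, map_zero])
      map_add' := fun x y ↦ hemb (by simp only [hf, AddMemClass.coe_add, map_add])
      commutes' := fun r ↦ hemb (by simp only [hf, hrat, map_ratCast]) }
  have hinv : Function.LeftInverse f f := fun x ↦ hemb (by simp only [hf, Complex.conj_conj])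
  exact ⟨AlgEquiv.ofBijective φ ⟨hinv.injective, hinv.surjective⟩, fun x ↦ hf x⟩


/-! ## §5 Coordinates on the genus field: `τ` and `ρ` on `K`, `√q`, `i`; the fixed field of `ρτ`; `√-7 ∉ J` -/

/-- the conjugation of `K = ℚ(√-q)` compatible with a complex embedding. [folklore] -/
theorem exists_conj_imaginaryQuadratic (hK : IsImaginaryQuadratic K) (ι : K →+* ℂ) {q : ℕ} (hq : q.Prime) {θK : K}
    (hθK : θK ^ 2 = -(q : K)) :
    ∃ σK : K →ₐ[ℚ] K, σK θK = -θK ∧ (∀ a, conj (ι a) = ι (σK a)) ∧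
      (∀ a, σK a = a → ∃ u : ℚ, a = u) ∧ (∀ a, σK a = -a → ∃ v : ℚ, a = v * θK) := by
  have hθr := sqrtNeg_not_mem_range_rat hq hθK
  have hc : θK ^ 2 = algebraMap ℚ K (-(q : ℚ)) := by rw [hθK]; simp
  haveI : NeZero (2 : ℚ) := ⟨two_ne_zero⟩
  set σK := Literature.NumberTheory.QuadraticFields.Quadratic.conj hK.1 hθr hc with hσK
  have hgen : σK θK = -θK := conj_gen hK.1 hθr hc
  have hσid : σK ≠ AlgHom.id ℚ K := by
    intro h
    have h1 : σK θK = θK := by rw [h]; rfl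
    rw [hgen] at h1
    have : θK = 0 := by linear_combination h1 / (-2)
    exact ne_zero_of_not_mem_range hθr this
  refine ⟨σK, hgen, fun a ↦ ?_, fun a ha ↦ ?_, fun a ha ↦ ?_⟩
  · have := RingHom.congr_fun (comp_eq_conjugate_of_ne_id hK ι hσid) a
    simpa using this.symm
  · obtain ⟨u, hu⟩ := exists_eq_algebraMap_of_conj_eq hK.1 hθr hc ha
    exact ⟨u, by rw [hu, eq_ratCast]⟩
  · obtain ⟨v, hv⟩ := exists_eq_mul_of_conj_eq_neg hK.1 hθr hc ha
    exact ⟨v, by rw [hv, eq_ratCast]⟩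

variable {ι : K →+* ℂ} {J : IntermediateField K (singularModuliField K ι)}

/-- the embedding `J ⊂ H_K ⊂ ℂ` is injective. [folklore] -/
theorem genusField_coe_injective :
    Function.Injective fun x : J ↦ ((x : singularModuliField K ι) : ℂ) :=
  fun _ _ h ↦ Subtype.ext (Subtype.ext h)

/-- a square root of `q` in `J` given as the real number `√q`. [folklore] -/
theorem sq_eq_of_coe_eq_sqrt {q : ℕ} {sJ : J}
    (hsr : ((sJ : singularModuliField K ι) : ℂ) = ((Real.sqrt q : ℝ) : ℂ)) :
    (sJ : singularModuliField K ι) ^ 2 = (q : singularModuliField K ι) := by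
  apply Subtype.ext
  show ((sJ : singularModuliField K ι) : ℂ) ^ 2 = ((q : singularModuliField K ι) : ℂ)
  rw [hsr, ← Complex.ofReal_pow, Real.sq_sqrt (Nat.cast_nonneg q)]
  simp

/-- `τ` (complex conjugation on `J`) fixes `√q`. [folklore] -/
theorem genusField_tau_apply_sqrt {q : ℕ} {sJ : J} (hsr : ((sJ : singularModuliField K ι) : ℂ) = ((Real.sqrt q : ℝ) : ℂ))
    {τ : J ≃ₐ[ℚ] J} (hτ : ∀ x : J, (((τ x : J) : singularModuliField K ι) : ℂ) =
      conj ((x : singularModuliField K ι) : ℂ)) : τ sJ = sJ :=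
  genusField_coe_injective (by simp only [hτ, hsr, Complex.conj_ofReal])

/-- `τ` acts on `K ⊂ J` as the conjugation of `K`. [folklore] -/
theorem genusField_tau_apply_algebraMap {σK : K →ₐ[ℚ] K} (hισ : ∀ a, conj (ι a) = ι (σK a))
    {τ : J ≃ₐ[ℚ] J} (hτ : ∀ x : J, (((τ x : J) : singularModuliField K ι) : ℂ) =
      conj ((x : singularModuliField K ι) : ℂ)) (a : K) :
    τ (algebraMap K J a) = algebraMap K J (σK a) :=
  genusField_coe_injective (by simp only [hτ]; exact hισ a)

/-- `τ i = -i` for `i² = -1`. [folklore] -/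
theorem genusField_tau_apply_eq_neg_of_sq {i : J} (hi : i ^ 2 = -1)
    {τ : J ≃ₐ[ℚ] J} (hτ : ∀ x : J, (((τ x : J) : singularModuliField K ι) : ℂ) =
      conj ((x : singularModuliField K ι) : ℂ)) : τ i = -i := by
  apply genusField_coe_injective
  have hi' : ((i : singularModuliField K ι) : ℂ) ^ 2 = -1 := by
    have := congrArg (fun x : J ↦ ((x : singularModuliField K ι) : ℂ)) hi
    simpa using this
  simp only [hτ, conj_eq_neg_of_sq_eq_neg_one hi']
  simp

/-- `i = θ_K √q / q ∈ J` with `i² = -1`. [folklore] -/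
theorem genusField_exists_i {q : ℕ} (hq : q.Prime) {θK : K} (hθK : θK ^ 2 = -(q : K)) {sJ : J}
    (hs : (sJ : singularModuliField K ι) ^ 2 = (q : singularModuliField K ι)) :
    ∃ i : J, i ^ 2 = -1 ∧ (q : J) * i = algebraMap K J θK * sJ := by
  have hq0 : (q : J) ≠ 0 := by exact_mod_cast hq.ne_zero
  have hs' : sJ ^ 2 = (q : J) := by
    apply Subtype.ext
    simpa using hs
  refine ⟨algebraMap K J θK * sJ / q, ?_, ?_⟩
  · rw [div_pow, mul_pow, hs', ← map_pow, hθK, map_neg, map_natCast]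
    field_simp
  · field_simp

/-- `ρ i = -i` when `ρ` fixes `K` and negates `√q`. [folklore] -/
theorem genusField_rho_apply_i {q : ℕ} (hq : q.Prime) {θK : K} {sJ i : J} (hi : (q : J) * i = algebraMap K J θK * sJ)
    {ρ : J ≃ₐ[ℚ] J} (hρK : ∀ a : K, ρ (algebraMap K J a) = algebraMap K J a) (hρs : ρ sJ = -sJ) :
    ρ i = -i := by
  have hq0 : (q : J) ≠ 0 := by exact_mod_cast hq.ne_zero
  have h := congrArg ρ hi
  rw [map_mul, map_natCast, map_mul, hρK, hρs, mul_neg, ← hi, ← mul_neg] at h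
  exact mul_left_cancel₀ hq0 h

/-- **The fixed field of `ρτ` is `ℚ(i)`**: `ρ (τ x) = x ⟹ x = u + v i` with `u, v ∈ ℚ`. [folklore] -/
theorem exists_rat_of_rho_tau_fixed (hK : IsImaginaryQuadratic K) {q : ℕ} (hq : q.Prime)
    (hdK : NumberField.discr K = -(4 * (q : ℤ))) (hJ2 : Module.finrank K J = 2) {θK : K}
    {σK : K →ₐ[ℚ] K} (hισ : ∀ a, conj (ι a) = ι (σK a))
    (hfix : ∀ a, σK a = a → ∃ u : ℚ, a = u) (hneg : ∀ a, σK a = -a → ∃ v : ℚ, a = v * θK) {sJ i : J}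
    (hsr : ((sJ : singularModuliField K ι) : ℂ) = ((Real.sqrt q : ℝ) : ℂ))
    (hi : (q : J) * i = algebraMap K J θK * sJ) {ρ τ : J ≃ₐ[ℚ] J}
    (hρK : ∀ a : K, ρ (algebraMap K J a) = algebraMap K J a) (hρs : ρ sJ = -sJ)
    (hτ : ∀ x : J, (((τ x : J) : singularModuliField K ι) : ℂ) = conj ((x : singularModuliField K ι) : ℂ))
    (x : J) (hx : ρ (τ x) = x) : ∃ u v : ℚ, x = u + v * i := by
  have hs := sq_eq_of_coe_eq_sqrt hsr
  have hsK := sqrt_not_mem_range_algebraMap_fixedField hK ι hq hdK hs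
  obtain ⟨a, b, hab⟩ := exists_eq_add_mul hJ2 hsK x
  have hρτ : ρ (τ x) = algebraMap K J (σK a) + algebraMap K J (-σK b) * sJ := by
    rw [hab, map_add, map_mul, genusField_tau_apply_algebraMap hισ hτ, genusField_tau_apply_algebraMap hισ hτ, genusField_tau_apply_sqrt hsr hτ,
      map_add, map_mul, hρK, hρK, hρs, map_neg]
    ring
  rw [hx, hab] at hρτ
  obtain ⟨ha, hb⟩ := ext_add_mul hsK hρτ
  obtain ⟨u, hu⟩ := hfix a ha.symm
  obtain ⟨v, hv⟩ := hneg b (by linear_combination hb)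
  refine ⟨u, v * q, ?_⟩
  rw [hab, hu, hv, map_ratCast, map_mul, map_ratCast]
  push_cast
  linear_combination (v : J) * hi.symm

/-- `√-7 ∉ J = ℚ(i, √-q)` for `q ≠ 7`: `x² ≠ -7` for every `x ∈ J`. [folklore] -/
theorem sq_ne_neg_seven (hK : IsImaginaryQuadratic K) {q : ℕ} (hq : q.Prime) (hq7 : q ≠ 7)
    (hdK : NumberField.discr K = -(4 * (q : ℤ))) (hJ2 : Module.finrank K J = 2) {θK : K}
    (hθK : θK ^ 2 = -(q : K)) {sJ : J}
    (hs : (sJ : singularModuliField K ι) ^ 2 = (q : singularModuliField K ι)) (x : J) : x ^ 2 ≠ -7 := by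
  intro hx
  have hsK := sqrt_not_mem_range_algebraMap_fixedField hK ι hq hdK hs
  have hs' : sJ ^ 2 = (q : J) := by
    apply Subtype.ext
    simpa using hs
  have hθr := sqrtNeg_not_mem_range_rat hq hθK
  obtain ⟨a, b, rfl⟩ := exists_eq_add_mul hJ2 hsK x
  -- `(a + b s)² = (a² + q b²) + 2ab s`
  have hsq : (algebraMap K J a + algebraMap K J b * sJ) ^ 2 =
      algebraMap K J (a ^ 2 + q * b ^ 2) + algebraMap K J (2 * a * b) * sJ := by
    simp only [map_add, map_mul, map_pow, map_natCast, map_ofNat]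
    linear_combination (algebraMap K J b) ^ 2 * hs'
  rw [hsq, show (-7 : J) = algebraMap K J (-7) + algebraMap K J 0 * sJ by
    simp only [map_neg, map_ofNat, map_zero, zero_mul, add_zero]] at hx
  obtain ⟨h1, h2⟩ := ext_add_mul hsK hx
  have hq0 : (0 : ℚ) < q := by exact_mod_cast hq.pos
  rcases mul_eq_zero.mp h2 with h3 | hb0
  · rcases mul_eq_zero.mp h3 with h4 | ha0
    · norm_num at h4
    · -- `a = 0`: `q b² = -7` in `K`; write `b = u + v θ`
      rw [ha0] at h1
      obtain ⟨u, v, rfl⟩ := exists_eq_add_mul hK.1 hθr b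
      have hsq' : (q : K) * (algebraMap ℚ K u + algebraMap ℚ K v * θK) ^ 2 =
          algebraMap ℚ K (q * (u ^ 2 - q * v ^ 2)) + algebraMap ℚ K (q * (2 * u * v)) * θK := by
        simp only [map_sub, map_mul, map_pow, map_natCast, map_ofNat]
        linear_combination (q : K) * (algebraMap ℚ K v) ^ 2 * hθK
      rw [zero_pow two_ne_zero, zero_add, hsq',
        show (-7 : K) = algebraMap ℚ K (-7) + algebraMap ℚ K 0 * θK by
          simp only [map_neg, map_ofNat, map_zero, zero_mul, add_zero]] at h1
      obtain ⟨h5, h6⟩ := ext_add_mul hθr h1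
      have hq0' : (q : ℚ) ≠ 0 := by exact_mod_cast hq.ne_zero
      rcases mul_eq_zero.mp h6 with h7 | h7
      · exact hq0' h7
      rcases mul_eq_zero.mp h7 with h8 | hv0
      · rcases mul_eq_zero.mp h8 with h9 | hu0
        · norm_num at h9
        · rw [hu0] at h5
          -- `-q² v² = -7`
          have : ((q : ℚ) * v) ^ 2 = 7 := by linear_combination -h5
          exact rat_sq_ne_natPrime (p := 7) (by norm_num) ((q : ℚ) * v) (by rw [this]; norm_num)
      · rw [hv0] at h5
        -- `q u² = -7`
        nlinarith [sq_nonneg u]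
  · -- `b = 0`: `a² = -7` in `K`
    rw [hb0] at h1
    obtain ⟨u, v, rfl⟩ := exists_eq_add_mul hK.1 hθr a
    have hsq' : (algebraMap ℚ K u + algebraMap ℚ K v * θK) ^ 2 + (q : K) * 0 ^ 2 =
        algebraMap ℚ K (u ^ 2 - q * v ^ 2) + algebraMap ℚ K (2 * u * v) * θK := by
      simp only [map_sub, map_mul, map_pow, map_natCast, map_ofNat]
      linear_combination (algebraMap ℚ K v) ^ 2 * hθK
    rw [hsq', show (-7 : K) = algebraMap ℚ K (-7) + algebraMap ℚ K 0 * θK by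
      simp only [map_neg, map_ofNat, map_zero, zero_mul, add_zero]] at h1
    obtain ⟨h5, h6⟩ := ext_add_mul hθr h1
    rcases mul_eq_zero.mp h6 with h7 | hv0
    · rcases mul_eq_zero.mp h7 with h8 | hu0
      · norm_num at h8
      · rw [hu0] at h5
        -- `q v² = 7`
        exact prime_mul_rat_sq_ne_seven hq hq7 v (by linear_combination -h5)
    · rw [hv0] at h5
      nlinarith [sq_nonneg u]

/-- `[J : ℚ] = 4`. [folklore] -/
theorem finrank_rat_eq_four (hK : IsImaginaryQuadratic K) (hJ2 : Module.finrank K J = 2) :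
    Module.finrank ℚ J = 4 := by
  rw [← Module.finrank_mul_finrank ℚ K J, hK.1, hJ2]

end GenusField

end Summit.BirchSwinnertonDyer.BirchSwinnertonDyer.Theorems.GoldfeldGoodTwists

end
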